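import Summits.Parity.GeneralizedHardyLittlewood.Theorems.BeyondDiagonalBeatsQuarter.KernelFormXSqSums
import HarnessLib

/-!
# Summation lemmas for the `X²` kernel form, II: `D(pm) ≤ 2D(m)`, the `κ`-weighted sum, the prime sum

Supports stmt-Parity-20343 (`PrimeLevelFamEdge.BeyondDiagonalBeatsQuarter`, K_B; line
`diagonal_kernel_split`, registered stub `stub_kernelFormXSq`). A helper; it closes nothing. Namespace
`Summit.Parity.GeneralizedHardyLittlewood.Theorems.BeyondDiagonalBeatsQuarter.KernelFormXSq`.

* `divWeight_prime_mul_le` — `D(pm) ≤ 2D(m)` for a prime `p` (the divisors of `pm` are divisors of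
  `m` or `p` times divisors of `m`);
* `sum_kappa_divWeight_sq_div_le` — `Σ_{n ≤ N} κ(n)D(n)²/n ≤ 48Z₂(2 + log N)`,
  `κ(n) = Σ_{p∣n} log p/(p−1)` (`log p/(p(p−1)) ≤ 4p^{−3/2}`, `Σ a^{−3/2} ≤ 3`);
* `primeSum_weight_le` — `Σ_{p ≤ K prime, p∤n} log p/(p+1)·|S_{np}| ≤ B(log K + log 4)` for a
  bound `|S_{np}| ≤ B` (tree: `MertensBound.sum_log_div_prime_le`, Chebyshev).

Everything here is PROVED (theorems only).
«The programme SEARCHES and TYPES; no claim about Landau–Siegel zeros, Theorems 1–2 of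
arXiv:2211.02515 or a repaired Margin232 until a kernel theorem says so.»
-/

noncomputable section

open scoped Real ArithmeticFunction.Moebius ArithmeticFunction.sigma ArithmeticFunction.zeta
open Finset ArithmeticFunction

namespace Summit.Parity.GeneralizedHardyLittlewood.Theorems.BeyondDiagonalBeatsQuarter.KernelFormXSq

open Literature.NumberTheory.LFunctions Literature.NumberTheory.LFunctions.KMV2000
open Literature.NumberTheory.Sieve.PowerfulPart (sum_Icc_one_div_mul_sqrt_le)
open SelbergCoord (kappa)
open Literature.Barriers.Parity (Icc_one_eq_Ioc_zero)

/-! ### `D(pm) ≤ 2 D(m)` -/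

/-- For a prime `p` and `m ≥ 1`, every divisor of `pm` is a divisor of `m` or `p` times one:
`(pm).divisors ⊆ m.divisors ∪ p·m.divisors`. [folklore] -/
theorem divisors_prime_mul_subset {p m : ℕ} (hp : p.Prime) (hm : m ≠ 0) :
    (p * m).divisors ⊆ m.divisors ∪ (m.divisors).image (fun d ↦ p * d) := by
  intro d hd
  have hd' := Nat.mem_divisors.1 hd
  rw [Finset.mem_union, Finset.mem_image]
  by_cases hpd : p ∣ d
  · right
    obtain ⟨d', rfl⟩ := hpd
    refine ⟨d', Nat.mem_divisors.2 ⟨?_, hm⟩, rfl⟩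
    exact Nat.dvd_of_mul_dvd_mul_left hp.pos hd'.1
  · left
    exact Nat.mem_divisors.2 ⟨(Nat.Coprime.dvd_of_dvd_mul_left
      ((Nat.Prime.coprime_iff_not_dvd hp).2 hpd).symm hd'.1), hm⟩

/-- **`D(pm) ≤ 2D(m)`** for `p` prime, `m ≥ 1` (`(pd)^{−3/4} ≤ d^{−3/4}`). [folklore] -/
theorem divWeight_prime_mul_le {p m : ℕ} (hp : p.Prime) (hm : m ≠ 0) :
    divWeight (p * m) ≤ 2 * divWeight m := by
  unfold divWeight
  have hnn : ∀ d ∈ m.divisors ∪ (m.divisors).image (fun d ↦ p * d), 0 ≤ (d : ℝ) ^ (-(3 / 4 : ℝ)) :=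
    fun d _ ↦ by positivity
  calc ∑ d ∈ (p * m).divisors, (d : ℝ) ^ (-(3 / 4 : ℝ))
      ≤ ∑ d ∈ m.divisors ∪ (m.divisors).image (fun d ↦ p * d), (d : ℝ) ^ (-(3 / 4 : ℝ)) :=
        Finset.sum_le_sum_of_subset_of_nonneg (divisors_prime_mul_subset hp hm) fun d hd _ ↦ hnn d hd
    _ ≤ ∑ d ∈ m.divisors, (d : ℝ) ^ (-(3 / 4 : ℝ)) +
          ∑ d ∈ (m.divisors).image (fun d ↦ p * d), (d : ℝ) ^ (-(3 / 4 : ℝ)) := by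
        have h := Finset.sum_union_inter (s₁ := m.divisors) (s₂ := (m.divisors).image (fun d ↦ p * d))
          (f := fun d ↦ (d : ℝ) ^ (-(3 / 4 : ℝ)))
        have h0 : 0 ≤ ∑ d ∈ m.divisors ∩ (m.divisors).image (fun d ↦ p * d), (d : ℝ) ^ (-(3 / 4 : ℝ)) :=
          Finset.sum_nonneg fun d _ ↦ by positivity
        linarith
    _ ≤ ∑ d ∈ m.divisors, (d : ℝ) ^ (-(3 / 4 : ℝ)) + ∑ d ∈ m.divisors, (d : ℝ) ^ (-(3 / 4 : ℝ)) := by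
        refine add_le_add le_rfl ?_
        rw [Finset.sum_image fun x _ y _ h ↦ (Nat.mul_right_inj hp.ne_zero).1 h]
        refine Finset.sum_le_sum fun d hd ↦ ?_
        have hd0 : (0 : ℝ) < d := by exact_mod_cast Nat.pos_of_mem_divisors hd
        have hp1 : (1 : ℝ) ≤ p := by exact_mod_cast hp.one_lt.le
        push_cast
        rw [Real.mul_rpow (by positivity) hd0.le]
        refine mul_le_of_le_one_left (by positivity) ?_
        exact Real.rpow_le_one_of_one_le_of_nonpos hp1 (by norm_num)
    _ = 2 * ∑ d ∈ m.divisors, (d : ℝ) ^ (-(3 / 4 : ℝ)) := by ring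

/-! ### The `κ`-weighted sum -/

/-- `log p/(p(p−1)) ≤ 4·p^{−3/2}` for `p ≥ 2` (`log p ≤ 2√p`, `p − 1 ≥ p/2`). [folklore] -/
theorem log_div_mul_sub_one_le {p : ℕ} (hp : 2 ≤ p) :
    Real.log p / ((p : ℝ) * ((p : ℝ) - 1)) ≤ 4 * (1 / ((p : ℝ) * Real.sqrt p)) := by
  have hp2 : (2 : ℝ) ≤ p := by exact_mod_cast hp
  have hp0 : (0 : ℝ) < p := by linarith
  have hsqrt0 : 0 < Real.sqrt p := Real.sqrt_pos.2 hp0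
  have hlog : Real.log p ≤ 2 * Real.sqrt p := by
    have h := Real.log_le_rpow_div hp0.le (show (0 : ℝ) < 1 / 2 by norm_num)
    rw [← Real.sqrt_eq_rpow] at h
    linarith
  rw [div_le_iff₀ (by nlinarith), show 4 * (1 / ((p : ℝ) * Real.sqrt p)) * ((p : ℝ) * ((p : ℝ) - 1)) =
    4 * ((p : ℝ) - 1) / Real.sqrt p by field_simp]
  rw [le_div_iff₀ hsqrt0]
  have hss : Real.sqrt p * Real.sqrt p = p := Real.mul_self_sqrt hp0.le
  nlinarith

/-- **`Σ_{n ≤ N} κ(n)D(n)²/n ≤ 48Z₂(2 + log N)`** (`N ≥ 1`): write `κ(n) = Σ_{p∣n} log p/(p−1)`, exchange,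
use `D(pm) ≤ 2D(m)`, `Σ_{m≤N/p} D(m)²/m ≤ Z₂(2 + log N)` and `Σ_p log p/(p(p−1)) ≤ 12`. [folklore] -/
theorem sum_kappa_divWeight_sq_div_le {N : ℕ} (hN : 1 ≤ N) :
    ∑ n ∈ Icc 1 N, kappa n * divWeight n ^ 2 / n ≤
      48 * (∑' d : ℕ, (d : ℝ) ^ (-(5 / 4 : ℝ))) ^ 2 * (2 + Real.log N) := by
  set Z₂ : ℝ := (∑' d : ℕ, (d : ℝ) ^ (-(5 / 4 : ℝ))) ^ 2 with hZ₂
  have hZ0 : 0 ≤ Z₂ := sq_nonneg _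
  have hlogN : 0 ≤ Real.log N := Real.log_nonneg (by exact_mod_cast hN)
  set P := (Icc 1 N).filter Nat.Prime with hP
  -- exchange `Σ_n Σ_{p | n}` into `Σ_p Σ_{n : p | n}`
  have h1 : ∑ n ∈ Icc 1 N, kappa n * divWeight n ^ 2 / n =
      ∑ p ∈ P, ∑ n ∈ (Icc 1 N).filter (fun n ↦ p ∣ n),
        Real.log p / ((p : ℝ) - 1) * (divWeight n ^ 2 / n) := by
    have hre : ∀ n ∈ Icc 1 N, kappa n * divWeight n ^ 2 / n =
        ∑ p ∈ n.primeFactors, Real.log p / ((p : ℝ) - 1) * (divWeight n ^ 2 / n) := by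
      intro n _
      rw [kappa, Finset.sum_mul, Finset.sum_div]
      exact Finset.sum_congr rfl fun p _ ↦ by ring
    rw [Finset.sum_congr rfl hre]
    refine Finset.sum_comm' fun n p ↦ ?_
    simp only [hP, Finset.mem_filter, Finset.mem_Icc, Nat.mem_primeFactors]
    constructor
    · rintro ⟨⟨hn1, hnN⟩, hp, hpn, hn0⟩
      exact ⟨⟨⟨hn1, hnN⟩, hpn⟩, ⟨hp.one_lt.le, (Nat.le_of_dvd (by omega) hpn).trans hnN⟩, hp⟩
    · rintro ⟨⟨⟨hn1, hnN⟩, hpn⟩, ⟨-, -⟩, hp⟩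
      exact ⟨⟨hn1, hnN⟩, hp, hpn, by omega⟩
  rw [h1]
  -- bound each inner sum
  have h2 : ∀ p ∈ P, ∑ n ∈ (Icc 1 N).filter (fun n ↦ p ∣ n),
      Real.log p / ((p : ℝ) - 1) * (divWeight n ^ 2 / n) ≤
        4 * (1 / ((p : ℝ) * Real.sqrt p)) * (4 * (Z₂ * (2 + Real.log N))) := by
    intro p hp
    have hp' : p.Prime := (Finset.mem_filter.1 hp).2
    have hpN : p ≤ N := (Finset.mem_Icc.1 (Finset.mem_filter.1 hp).1).2
    have hp2 : (2 : ℝ) ≤ p := by exact_mod_cast hp'.two_le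
    have hp0 : (0 : ℝ) < p := by linarith
    rw [← Finset.mul_sum, Finset.sum_filter, sum_Icc_ite_dvd_eq hp'.ne_zero]
    -- `Σ_{m ≤ N/p} D(pm)²/(pm) ≤ (4/p) Σ_m D(m)²/m`
    have hNp : 1 ≤ N / p := (Nat.le_div_iff_mul_le hp'.pos).2 (by simpa using hpN)
    have h3 : ∑ m ∈ Icc 1 (N / p), divWeight (p * m) ^ 2 / (((p * m : ℕ) : ℝ)) ≤
        (4 / p) * ∑ m ∈ Icc 1 (N / p), divWeight m ^ 2 / m := by
      rw [Finset.mul_sum]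
      refine Finset.sum_le_sum fun m hm ↦ ?_
      have hm0 : m ≠ 0 := by have := (Finset.mem_Icc.1 hm).1; omega
      have hm0' : (0 : ℝ) < m := by exact_mod_cast Nat.pos_of_ne_zero hm0
      have hD := divWeight_prime_mul_le hp' hm0
      have hD0 := divWeight_nonneg (p * m)
      push_cast
      rw [div_le_iff₀ (by positivity)]
      calc divWeight (p * m) ^ 2 ≤ (2 * divWeight m) ^ 2 := pow_le_pow_left₀ hD0 hD 2
        _ = 4 / p * (divWeight m ^ 2 / m) * (p * m) := by field_simp; ring
    have h4 : ∑ m ∈ Icc 1 (N / p), divWeight m ^ 2 / m ≤ Z₂ * (2 + Real.log N) := by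
      refine (sum_divWeight_sq_div_le hNp).trans ?_
      refine mul_le_mul_of_nonneg_left ?_ hZ0
      have : Real.log ((N / p : ℕ) : ℝ) ≤ Real.log N :=
        Real.log_le_log (by exact_mod_cast hNp) (by exact_mod_cast Nat.div_le_self N p)
      linarith
    have hcoef : Real.log p / ((p : ℝ) - 1) * (4 / p) ≤ 4 * (1 / ((p : ℝ) * Real.sqrt p)) * 4 := by
      have := log_div_mul_sub_one_le hp'.two_le
      rw [show Real.log p / ((p : ℝ) - 1) * (4 / p) = Real.log p / ((p : ℝ) * ((p : ℝ) - 1)) * 4 by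
        field_simp]
      exact mul_le_mul_of_nonneg_right this (by norm_num)
    have hlog0 : 0 ≤ Real.log p / ((p : ℝ) - 1) := div_nonneg (Real.log_nonneg (by linarith)) (by linarith)
    calc Real.log p / ((p : ℝ) - 1) * ∑ m ∈ Icc 1 (N / p), divWeight (p * m) ^ 2 / (((p * m : ℕ) : ℝ))
        ≤ Real.log p / ((p : ℝ) - 1) * ((4 / p) * (Z₂ * (2 + Real.log N))) :=
          mul_le_mul_of_nonneg_left (h3.trans (mul_le_mul_of_nonneg_left h4 (by positivity))) hlog0
      _ = (Real.log p / ((p : ℝ) - 1) * (4 / p)) * (Z₂ * (2 + Real.log N)) := by ring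
      _ ≤ (4 * (1 / ((p : ℝ) * Real.sqrt p)) * 4) * (Z₂ * (2 + Real.log N)) :=
          mul_le_mul_of_nonneg_right hcoef (by positivity)
      _ = 4 * (1 / ((p : ℝ) * Real.sqrt p)) * (4 * (Z₂ * (2 + Real.log N))) := by ring
  refine (Finset.sum_le_sum h2).trans ?_
  rw [← Finset.sum_mul, ← Finset.mul_sum]
  have h5 : ∑ p ∈ P, 1 / ((p : ℝ) * Real.sqrt p) ≤ 3 := by
    refine le_trans ?_ (sum_Icc_one_div_mul_sqrt_le N)
    exact Finset.sum_le_sum_of_subset_of_nonneg (Finset.filter_subset _ _) fun a _ _ ↦ by positivity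
  calc (4 * ∑ p ∈ P, 1 / ((p : ℝ) * Real.sqrt p)) * (4 * (Z₂ * (2 + Real.log N)))
      ≤ (4 * 3) * (4 * (Z₂ * (2 + Real.log N))) := by gcongr
    _ = 48 * Z₂ * (2 + Real.log N) := by ring

/-! ### The prime sum of the von Mangoldt coupling -/

/-- `Σ_{j ≤ K, j prime, j∤n} log j/(j+1)·B ≤ B·(log K + log 4)` for `B ≥ 0`: the weights are
`≤ log p/p` and `Σ_{p≤K} log p/p ≤ log K + log 4` (Chebyshev, tree `MertensBound.sum_log_div_prime_le`).
[folklore] -/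
theorem sum_prime_log_div_succ_le (n K : ℕ) {B : ℝ} (hB : 0 ≤ B) :
    ∑ j ∈ Icc 1 K, (if j.Prime ∧ ¬ j ∣ n then Real.log j / ((j : ℝ) + 1) * B else 0) ≤
      B * (Real.log K + Real.log 4) := by
  have hM := MertensBound.sum_log_div_prime_le K
  have h1 : ∑ j ∈ Icc 1 K, (if j.Prime ∧ ¬ j ∣ n then Real.log j / ((j : ℝ) + 1) * B else 0) ≤
      ∑ j ∈ Icc 1 K, (if j.Prime then Real.log j / j * B else 0) := by
    refine Finset.sum_le_sum fun j hj ↦ ?_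
    have hj0 : (0 : ℝ) < j := by exact_mod_cast (Finset.mem_Icc.1 hj).1
    have hlog : 0 ≤ Real.log j := Real.log_nonneg (by exact_mod_cast (Finset.mem_Icc.1 hj).1)
    by_cases hpr : j.Prime
    · by_cases hdn : j ∣ n
      · rw [if_neg (fun h ↦ h.2 hdn), if_pos hpr]; positivity
      · rw [if_pos ⟨hpr, hdn⟩, if_pos hpr]
        refine mul_le_mul_of_nonneg_right ?_ hB
        exact div_le_div_of_nonneg_left hlog hj0 (by linarith)
    · rw [if_neg (fun h ↦ hpr h.1), if_neg hpr]
  refine h1.trans ?_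
  rw [← Finset.sum_filter]
  have hset : (Icc 1 K).filter Nat.Prime = Nat.primesLE K := by
    ext j
    simp only [Finset.mem_filter, Finset.mem_Icc, Nat.mem_primesLE]
    constructor
    · rintro ⟨⟨-, hjK⟩, hp⟩; exact ⟨hjK, hp⟩
    · rintro ⟨hjK, hp⟩; exact ⟨⟨hp.one_lt.le, hjK⟩, hp⟩
  rw [hset, ← Finset.sum_mul, mul_comm]
  exact mul_le_mul_of_nonneg_left hM hB

end Summit.Parity.GeneralizedHardyLittlewood.Theorems.BeyondDiagonalBeatsQuarter.KernelFormXSq
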